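import Mathlib
import HarnessLib

/-!
# The endgame of Bernert's argument (real-variable inequalities)

Topic `NumberTheory/DiophantineGeometry`; auxiliary file for the proof of
`Literature.NumberTheory.DiophantineGeometry.bernertEtAl2024_thm_1_2`
(Bernert–Browning–Lichtman–Teräväinen, arXiv:2410.12234 v2, Theorem 1.2), assembled in
`AbcExceptionalSetBoundsThm12Proofs`. This file isolates the purely algebraic "endgame"
[cite: Bernert2025, §4]: if `S` solutions survive, the geometry bound forces `P₁ ≤ 2P/S` (unless
`S ≤ 64P/W`, the harmless `X^{λ-1}` term), the Fourier bounds force `P_j ≤ K₁P⁴/S⁶`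
(`j = 2, 3, 4`), and then `P⁵ ≤ P₁⁴P₂³P₃²P₄ · (P₁P₂²P₃³P₄⁴ρ⁵) · K_q⁵ ≤ 16K₁⁶K_q⁵W³P²⁸/S⁴⁰`,
i.e. `S⁴⁰ ≤ 16 K₁⁶ K_q⁵ W³ P²³` (`endgame_dichotomy`); with `P ≪ W^{λ+o(1)}`,
`K₁, K_q ≪ W^{o(1)}` this is `S ≪ W^{(23λ+3)/40+o(1)}` (`bound_of_dichotomy`). Here `W = 2C`
is the dyadic size of `c`, `P = #𝒳#𝒴#𝒵`, `P_j = X_jY_jZ_j`, `ρ = ρ_aρ_bρ_c`.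

No definitions are introduced.
-/

namespace Literature.NumberTheory.DiophantineGeometry

namespace AbcExceptional

/-- **The endgame dichotomy** [Bernert2025, §4, proof of Thm. 1]: either the `X^{λ-1}`-term of the
geometry bound dominates (`S ≤ 64P/W`), or `S⁴⁰ ≤ 16 K₁⁶ K_q⁵ W³ P²³`. [cite: Bernert2025, §4] -/
theorem endgame_dichotomy {S P P₁ P₂ P₃ P₄ ρ W K₁ Kq : ℝ} (hS : 0 < S) (hP : 0 < P)
    (hP₁ : 0 < P₁) (hP₂ : 0 < P₂) (hP₃ : 0 < P₃) (hP₄ : 0 < P₄) (hρ : 0 < ρ) (hW : 0 < W)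
    (hK₁ : 0 < K₁) (hKq : 0 < Kq)
    (hGN : S ≤ P / P₁ + 32 * P / W)
    (hF2 : P₂ * S ^ 6 ≤ K₁ * P ^ 4) (hF3 : P₃ * S ^ 6 ≤ K₁ * P ^ 4)
    (hF4 : P₄ * S ^ 6 ≤ K₁ * P ^ 4)
    (hH1 : P₁ * P₂ ^ 2 * P₃ ^ 3 * P₄ ^ 4 * ρ ^ 5 ≤ W ^ 3)
    (hPle : P ≤ P₁ * P₂ * P₃ * P₄ * ρ * Kq) :
    S ≤ 64 * P / W ∨ S ^ 40 ≤ 16 * K₁ ^ 6 * Kq ^ 5 * W ^ 3 * P ^ 23 := by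
  by_cases hcase : S ≤ 64 * P / W
  · exact Or.inl hcase
  right
  push Not at hcase
  have hA : 32 * P / W < S / 2 := by
    have : 64 * P / W = 2 * (32 * P / W) := by ring
    linarith
  have hB : S * P₁ ≤ P + 32 * P / W * P₁ := by
    have := mul_le_mul_of_nonneg_right hGN hP₁.le
    rwa [add_mul, div_mul_cancel₀ _ hP₁.ne'] at this
  have hC : 32 * P / W * P₁ < S / 2 * P₁ := mul_lt_mul_of_pos_right hA hP₁
  have hP1 : P₁ ≤ 2 * P / S := by
    rw [le_div_iff₀ hS]
    nlinarith
  have hPj : ∀ {Pj : ℝ}, Pj * S ^ 6 ≤ K₁ * P ^ 4 → Pj ≤ K₁ * P ^ 4 / S ^ 6 := fun h => by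
    rw [le_div_iff₀ (pow_pos hS 6)]
    exact h
  have h2 := hPj hF2
  have h3 := hPj hF3
  have h4 := hPj hF4
  have key : P ^ 5 ≤ 16 * K₁ ^ 6 * Kq ^ 5 * W ^ 3 * P ^ 28 / S ^ 40 := by
    calc P ^ 5 ≤ (P₁ * P₂ * P₃ * P₄ * ρ * Kq) ^ 5 := pow_le_pow_left₀ hP.le hPle 5
      _ = (P₁ ^ 4 * P₂ ^ 3 * P₃ ^ 2 * P₄) * (P₁ * P₂ ^ 2 * P₃ ^ 3 * P₄ ^ 4 * ρ ^ 5) *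
            Kq ^ 5 := by ring
      _ ≤ ((2 * P / S) ^ 4 * (K₁ * P ^ 4 / S ^ 6) ^ 3 * (K₁ * P ^ 4 / S ^ 6) ^ 2 *
            (K₁ * P ^ 4 / S ^ 6)) * W ^ 3 * Kq ^ 5 := by gcongr
      _ = 16 * K₁ ^ 6 * Kq ^ 5 * W ^ 3 * P ^ 28 / S ^ 40 := by
          field_simp
          norm_num
  rw [le_div_iff₀ (pow_pos hS 40)] at key
  have hP5 : 0 < P ^ 5 := pow_pos hP 5
  calc S ^ 40 = (P ^ 5 * S ^ 40) / P ^ 5 := by field_simp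
    _ ≤ (16 * K₁ ^ 6 * Kq ^ 5 * W ^ 3 * P ^ 28) / P ^ 5 := div_le_div_of_nonneg_right key hP5.le
    _ = 16 * K₁ ^ 6 * Kq ^ 5 * W ^ 3 * P ^ 23 := by
        field_simp

/-- Fortieth roots: `S⁴⁰ ≤ M W^e` with `M, W ≥ 1` gives `S ≤ M W^{e/40}`. [folklore] -/
theorem le_of_pow_forty_le {S M W e : ℝ} (hS : 0 ≤ S) (hM : 1 ≤ M) (hW : 1 ≤ W)
    (h : S ^ 40 ≤ M * W ^ e) : S ≤ M * W ^ (e / 40) := by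
  have hW0 : 0 < W := by linarith
  have hM0 : 0 ≤ M := by linarith
  have h1 : S = (S ^ 40) ^ ((40 : ℝ)⁻¹) := by
    rw [← Real.rpow_natCast S 40, ← Real.rpow_mul hS]
    norm_num
  calc S = (S ^ 40) ^ ((40 : ℝ)⁻¹) := h1
    _ ≤ (M * W ^ e) ^ ((40 : ℝ)⁻¹) := Real.rpow_le_rpow (by positivity) h (by norm_num)
    _ = M ^ ((40 : ℝ)⁻¹) * W ^ (e / 40) := by
        rw [Real.mul_rpow hM0 (by positivity), ← Real.rpow_mul hW0.le]
        congr 1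
    _ ≤ M * W ^ (e / 40) := by
        gcongr
        calc M ^ ((40 : ℝ)⁻¹) ≤ M ^ (1 : ℝ) := Real.rpow_le_rpow_of_exponent_le hM (by norm_num)
          _ = M := Real.rpow_one M

/-- **From the dichotomy to the exponent `(23λ + 3)/40`.** With `K₁ ≤ A₁ W^{60η}`,
`K_q = K_t³ W^{5η}` and `P ≤ K_t³ W^{5η+λ}` (`λ ≤ 2`, `W ≥ 1`), either branch of
`endgame_dichotomy` gives `S ≤ (64K_t³ + 16A₁⁶K_t⁸⁴) · W^{(23λ+3)/40 + 25η/2}`; the first branch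
uses `λ − 1 ≤ (23λ + 3)/40`, i.e. `λ ≤ 43/17`. [cite: Bernert2025, §4] -/
theorem bound_of_dichotomy {S P W K₁ A₁ Kt l η : ℝ} (hS : 0 ≤ S) (hP : 0 ≤ P) (hW : 1 ≤ W)
    (hK₁ : 0 ≤ K₁) (hA₁ : 1 ≤ A₁) (hKt : 1 ≤ Kt) (hl : l ≤ 2) (hη : 0 ≤ η)
    (hK₁le : K₁ ≤ A₁ * W ^ (60 * η)) (hPle : P ≤ Kt ^ 3 * W ^ (5 * η + l))
    (hdich : S ≤ 64 * P / W ∨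
      S ^ 40 ≤ 16 * K₁ ^ 6 * (Kt ^ 3 * W ^ (5 * η)) ^ 5 * W ^ 3 * P ^ 23) :
    S ≤ (64 * Kt ^ 3 + 16 * A₁ ^ 6 * Kt ^ 84) * W ^ ((23 * l + 3) / 40 + 25 * η / 2) := by
  have hW0 : 0 < W := by linarith
  have hKt0 : 0 ≤ Kt := by linarith
  have hA0 : 0 ≤ A₁ := by linarith
  set θ : ℝ := (23 * l + 3) / 40 + 25 * η / 2 with hθ
  have hWθ : 0 ≤ W ^ θ := by positivity
  have hM1 : 1 ≤ 16 * A₁ ^ 6 * Kt ^ 84 := by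
    have h1 : 1 ≤ A₁ ^ 6 := one_le_pow₀ hA₁
    have h2 : 1 ≤ Kt ^ 84 := one_le_pow₀ hKt
    nlinarith
  rcases hdich with hA | hB
  · -- the `X^{λ-1}` branch
    have h1 : S ≤ 64 * Kt ^ 3 * W ^ (5 * η + l - 1) := by
      calc S ≤ 64 * P / W := hA
        _ ≤ 64 * (Kt ^ 3 * W ^ (5 * η + l)) / W := by gcongr
        _ = 64 * Kt ^ 3 * (W ^ (5 * η + l) / W) := by ring
        _ = 64 * Kt ^ 3 * W ^ (5 * η + l - 1) := by rw [Real.rpow_sub_one hW0.ne']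
    have h2 : W ^ (5 * η + l - 1) ≤ W ^ θ :=
      Real.rpow_le_rpow_of_exponent_le hW (by rw [hθ]; linarith)
    calc S ≤ 64 * Kt ^ 3 * W ^ (5 * η + l - 1) := h1
      _ ≤ 64 * Kt ^ 3 * W ^ θ := by gcongr
      _ ≤ (64 * Kt ^ 3 + 16 * A₁ ^ 6 * Kt ^ 84) * W ^ θ := by
          have : (0 : ℝ) ≤ 16 * A₁ ^ 6 * Kt ^ 84 * W ^ θ := by positivity
          nlinarith
  · -- the main branch
    have e1 : (A₁ * W ^ (60 * η)) ^ 6 = A₁ ^ 6 * W ^ (360 * η) := by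
      rw [mul_pow, ← Real.rpow_mul_natCast hW0.le]
      congr 2
      push_cast
      ring
    have e2 : (Kt ^ 3 * W ^ (5 * η)) ^ 5 = Kt ^ 15 * W ^ (25 * η) := by
      rw [mul_pow, ← Real.rpow_mul_natCast hW0.le, ← pow_mul]
      congr 2
      push_cast
      ring
    have e3 : (Kt ^ 3 * W ^ (5 * η + l)) ^ 23 = Kt ^ 69 * W ^ (115 * η + 23 * l) := by
      rw [mul_pow, ← Real.rpow_mul_natCast hW0.le, ← pow_mul]
      congr 2
      push_cast
      ring
    have e4 : W ^ (360 * η) * W ^ (25 * η) * W ^ (3 : ℝ) * W ^ (115 * η + 23 * l) =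
        W ^ (500 * η + 3 + 23 * l) := by
      rw [← Real.rpow_add hW0, ← Real.rpow_add hW0, ← Real.rpow_add hW0]
      congr 1
      ring
    have hSB : S ^ 40 ≤ (16 * A₁ ^ 6 * Kt ^ 84) * W ^ (500 * η + 3 + 23 * l) := by
      calc S ^ 40 ≤ 16 * K₁ ^ 6 * (Kt ^ 3 * W ^ (5 * η)) ^ 5 * W ^ 3 * P ^ 23 := hB
        _ ≤ 16 * (A₁ * W ^ (60 * η)) ^ 6 * (Kt ^ 3 * W ^ (5 * η)) ^ 5 * W ^ 3 *
              (Kt ^ 3 * W ^ (5 * η + l)) ^ 23 := by gcongr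
        _ = (16 * A₁ ^ 6 * Kt ^ 84) *
              (W ^ (360 * η) * W ^ (25 * η) * W ^ (3 : ℝ) * W ^ (115 * η + 23 * l)) := by
            rw [e1, e2, e3, ← Real.rpow_natCast W 3]
            push_cast
            ring
        _ = (16 * A₁ ^ 6 * Kt ^ 84) * W ^ (500 * η + 3 + 23 * l) := by rw [e4]
    have h1 := le_of_pow_forty_le hS hM1 hW hSB
    have hexp : (500 * η + 3 + 23 * l) / 40 = θ := by rw [hθ]; ring
    rw [hexp] at h1
    calc S ≤ 16 * A₁ ^ 6 * Kt ^ 84 * W ^ θ := h1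
      _ ≤ (64 * Kt ^ 3 + 16 * A₁ ^ 6 * Kt ^ 84) * W ^ θ := by
          have : (0 : ℝ) ≤ 64 * Kt ^ 3 * W ^ θ := by positivity
          nlinarith

end AbcExceptional

end Literature.NumberTheory.DiophantineGeometry
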